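import Summits.NavierStokesRegularity.NavierStokesRegularity.Theses.ExtremalEnstrophy

/-!
# Birth skeleton (BC3) of the crux `ExtremalEnstrophy.SplittingBound`

(crux item `stmt-NavierStokesRegularity-18665`, rank 4 of route
`route-NavierStokesRegularity-ExtremalEnstrophy` (rev 0); tree path
`Cruxes/SplittingBound/Lines/birth.lean`; registrar
`planner-skel-stmt-NavierStokesRegularity-18665-0`, 2026-08-17. `ledger crux ls`: no `Disproof.lean`,
no earlier lines, no crux ideas for this crux at registration, so there is no disprover obligation
(`_false_without_`) to honour yet.)

THE CRUX (V3, "splitting bound"). Fix `ν > 0`, a finite level `(E, Z, T)` of the maximal-enstrophy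
value function `𝒵 = maxEnstrophy ν` (`𝒵(E, Z, T) < ∞`) and a margin `γ > 0`. Then there is a
precision `ε > 0` such that along EVERY `ε`-profile-split sequence `D` at that level (admissible
Leray–Hopf trajectories `u n` within budget, observed at `t n ∈ [0, T]`, whose DATA split as
`u n 0 = Σ_j φ j (· - x n j) + r n`: fixed `H¹` profiles on diverging frames, a remainder weakly
null in every frame with `limsup ‖r n‖_{L³} ≤ ε`, budgets asymptotically orthogonal) the peak
enstrophy obeys `limsup_n ‖∇(u n)(t n)‖² ≤ Σ_j 𝒵(E, ‖∇φ j‖², T) + limsup_n ‖∇ r n‖² + γ`.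

THE CUT — the route's own foreseen layer 2 ("SplittingBound ⇐ RemainderDecay (small-`L³` data do
not grow enstrophy) → AsymptoticDecoupling", route header TWO-LAYER PLAN), with the existence of
the flows of the pieces made explicit so that no difficulty hides in an unnamed step and the
composition is honest order bookkeeping:

* `stub_finiteLevelFlows` [M–L in Lean; KNOWN in print]: at a finite level `𝒵(E, Z, T) < ∞`, every
  admissible datum within budget (`L²`, weakly divergence free, energy `≤ E`, enstrophy `≤ Z`)
  launches a Leray–Hopf trajectory living strictly past the horizon `T`. (Fujita–Kato `H¹` local
  theory, whose lifespan depends on the enstrophy only, + the a-priori bound `‖∇U(t)‖² ≤ 𝒵 < ∞`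
  for `t ≤ T` that finiteness of the level hands to every admissible trajectory: the route's lever
  "no estimate is ever asked of a generic trajectory" in miniature.)
* `stub_remainderFlows` [M–L; KNOWN in print modulo bookkeeping]: there is `ε₀ = ε₀(ν) > 0` such
  that the remainders `r n` of any profile-split sequence of precision `ε < ε₀` launch, eventually
  in `n`, Leray–Hopf trajectories on any `[0, S)` whose enstrophy never exceeds `‖∇ r n‖²`
  (Kato's global small-`L³` solution, tree `kato_global_small_holds`; it is Leray–Hopf,
  tree `IsKatoSolutionOn.isLerayHopfOn_of_memLp_two`; enstrophy is non-increasing while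
  `C_S ‖u(t)‖₃ ≤ ν`, from `d/dt ‖∇u‖² = -2ν‖∇²u‖² - 2∫(u·∇u)·Δu ≤ -2(ν - C_S‖u‖₃)‖∇²u‖²`).
* `stub_asymptoticDecoupling` [L–XL; OPEN — THE HEART]: for fine enough splits, the peak
  enstrophy of the sequence is asymptotically at most the SUM OF THE PEAK ENSTROPHIES OF THE
  PIECES' OWN FLOWS (+ `γ`): given any Leray–Hopf flows `P j` of the profiles past `T` and any
  eventual Leray–Hopf flows `R n` of the remainders past `T`,
  `limsup_n ‖∇(u n)(t n)‖² ≤ Σ_j sup_{[0,T]} ‖∇(P j)‖² + limsup_n sup_{[0,T]} ‖∇(R n)‖² + γ`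
  (nonlinear profile decomposition in the subcritical class `H¹` at fixed energy: far-apart
  strong profile flows decouple, Gallagher 2001 Thm 2; the `L³`-small, `H¹`-large remainder flow
  interacts with them only through forcings `div(P ⊗ R)` that are `O(ε)` in `Ḣ⁻¹` and bounded in
  `L²`, hence `O(√ε)` in `Ḣ^{-1/2}`, which the heat kernel integrates into an `o(1)` enstrophy
  defect — the step the crux's "why it might fail" doubts).

`SplittingBound_of : S0 → S1 → S2 → SplittingBound` (hypotheses = the stub statements through
their name-keyed aliases `__Registered.stub_*`, conclusion = the route decl BY NAME) is the real
composition: choose `ε = min ε₂ (ε₀/2)`; profile flows from S0 (the profiles ARE admissible data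
within budget: fields `profile_memLp`, `profile_divFree`, `profile_energy_le` and
`eWeakGradL2Sq_profile_le` of the split structure); remainder flows from S1; S2 bounds the peak by
the pieces' peaks; each profile peak is `≤ 𝒵(E, ‖∇φ j‖², T)` by the introduction rule
`eWeakGradL2Sq_le_maxEnstrophy` (the profile flow is itself admissible at budget
`(E, ‖∇φ j‖²)`), and the remainder peaks are eventually `≤ ‖∇ r n‖²` by S1, so
`Filter.limsup_le_limsup` closes. `lean check`: sorries ONLY in the three `stub_*` declarations.
BC3 probes (registrar folder `bc/probe_*.lean`): for each stub `S`, `S → SplittingBound` and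
`S → NavierStokesRegularity` by `first | exact? | simpa | aesop` FAIL.
-/

noncomputable section

open MeasureTheory Set Filter Topology Function
open scoped ENNReal NNReal

namespace Summit.NavierStokesRegularity.NavierStokesRegularity.Cruxes.SplittingBound.Birth

open Literature.Analysis.FluidPDE

set_option linter.unusedVariables false
set_option linter.dupNamespace false

local notation "ℝ³" => EuclideanSpace ℝ (Fin 3)

/-! ## The stub statements -/

/-- Statement of stub 0 (`stub_finiteLevelFlows`): **at a finite level of the value function,
admissible data within budget launch Leray–Hopf trajectories living past the horizon.** For
`ν > 0`, budgets `E, Z`, a horizon `T > 0` with `𝒵_ν(E, Z, T) < ∞`, and a datum `a ∈ L²`, weakly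
divergence free, with `∫|a|² ≤ E` and `‖∇a‖² ≤ Z`: some Leray–Hopf trajectory `U` with lifespan
`S > T` has `U 0 = a`. -/
def FiniteLevelFlows : Prop :=
  ∀ ν : ℝ, 0 < ν → ∀ (E Z : ℝ≥0) (T : ℝ), 0 < T → maxEnstrophy ν E Z T < ⊤ →
    ∀ a : ℝ³ → ℝ³, MemLp a 2 volume → IsWeaklyDivFree a → eEnergy a ≤ E →
      eWeakGradL2Sq a ≤ Z →
      ∃ S : ℝ, T < S ∧ ∃ U : ℝ → ℝ³ → ℝ³, IsLerayHopfTrajectory ν S U ∧ U 0 = a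

/-- Statement of stub 1 (`stub_remainderFlows`): **remainders of a fine profile split launch,
eventually, global flows that do not grow enstrophy.** For `ν > 0` there is `ε₀ > 0` such that
for every profile-split sequence `D` (any level, any horizon) of precision `ε < ε₀` and every
`S > 0` there are fields `R n` which, for all large `n`, are Leray–Hopf trajectories on `[0, S)`
issued from `r n` (`R n 0 = D.r n`) with `‖∇(R n)(t)‖² ≤ ‖∇ r n‖²` for `0 ≤ t < S`. -/
def RemainderFlows : Prop :=
  ∀ ν : ℝ, 0 < ν → ∃ ε₀ : ℝ, 0 < ε₀ ∧ ∀ (E Z : ℝ≥0) (T ε : ℝ), ε < ε₀ →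
    ∀ (J : ℕ) (D : ProfileSplitData J), IsProfileSplitSequence ν E Z T ε D →
      ∀ S : ℝ, 0 < S → ∃ R : ℕ → ℝ → ℝ³ → ℝ³, ∀ᶠ n in atTop,
        IsLerayHopfTrajectory ν S (R n) ∧ R n 0 = D.r n ∧
          ∀ t : ℝ, 0 ≤ t → t < S → eWeakGradL2Sq (R n t) ≤ eWeakGradL2Sq (D.r n)

/-- Statement of stub 2 (`stub_asymptoticDecoupling`): **asymptotic decoupling — for fine enough
splits at a finite level, the peak enstrophy of the sequence is at most the sum of the peak
enstrophies of the pieces' own flows, up to `γ`.** For `ν > 0`, a finite level `(E, Z, T)` and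
`γ > 0` there is `ε > 0` such that for every `ε`-profile-split sequence `D`, all Leray–Hopf flows
`P j` of the profiles with lifespans `S j > T` (`P j 0 = D.φ j`) and all fields `R n` that are
eventually Leray–Hopf flows of the remainders on `[0, S')`, `S' > T` (`R n 0 = D.r n`):
`limsup_n ‖∇(u n)(t n)‖² ≤ Σ_j ⨆_{t ∈ [0,T]} ‖∇(P j)(t)‖² + limsup_n ⨆_{t ∈ [0,T]} ‖∇(R n)(t)‖² + γ`. -/
def AsymptoticDecoupling : Prop :=
  ∀ ν : ℝ, 0 < ν → ∀ (E Z : ℝ≥0) (T : ℝ), 0 < E → 0 < Z → 0 < T → maxEnstrophy ν E Z T < ⊤ →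
    ∀ γ : ℝ≥0, 0 < γ → ∃ ε : ℝ, 0 < ε ∧ ∀ (J : ℕ) (D : ProfileSplitData J),
      IsProfileSplitSequence ν E Z T ε D →
      ∀ (S : Fin J → ℝ) (P : Fin J → ℝ → ℝ³ → ℝ³) (S' : ℝ) (R : ℕ → ℝ → ℝ³ → ℝ³),
        (∀ j, T < S j ∧ IsLerayHopfTrajectory ν (S j) (P j) ∧ P j 0 = D.φ j) → T < S' →
        (∀ᶠ n in atTop, IsLerayHopfTrajectory ν S' (R n) ∧ R n 0 = D.r n) →
        limsup (fun n => eWeakGradL2Sq (D.u n (D.t n))) atTop ≤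
          (∑ j, ⨆ t ∈ Icc 0 T, eWeakGradL2Sq (P j t)) +
            limsup (fun n => ⨆ t ∈ Icc 0 T, eWeakGradL2Sq (R n t)) atTop + γ

/-! ## The registered stubs -/

/-- **S0 `stub_finiteLevelFlows` — FINITE LEVEL ⇒ FLOWS WITHIN BUDGET LIVE PAST THE HORIZON**
(size M–L in Lean; KNOWN in print). WHY PLAUSIBLE: an admissible datum `a` within budget lies in
`H¹_σ` (`eEnergy a ≤ E`, `eWeakGradL2Sq a ≤ Z`), so the Fujita–Kato `H¹` theory gives a strong
solution `U` on a maximal interval `[0, S⋆)` whose local lifespan from any slice depends only on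
`ν` and the slice's enstrophy (Fujita–Kato 1964 Thm 1.1; Robinson–Rodrigo–Sadowski 2016 Thm 6.8 and
Lemma 6.11; tree `FujitaKatoLocal`, `TaoH1Mild*`, `LerayHopfClassicalContinuation`), and a strong
solution is a Leray–Hopf trajectory from `a` on every `[0, S']`, `S' < S⋆`
(`IsLerayHopfOn` of classical finite-energy solutions, tree `LerayHopf` §"smooth ⇒ Leray–Hopf").
Being admissible within budget, `U` obeys `‖∇U(t)‖² ≤ 𝒵_ν(E, Z, T) < ∞` for every
`t ≤ min(T, ·) < S⋆` (`eWeakGradL2Sq_le_maxEnstrophy`) — so if `S⋆ ≤ T` the enstrophy stays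
bounded up to `S⋆`, contradicting maximality (`H¹` blow-up criterion); hence `S⋆ > T` and any
`S ∈ (T, S⋆)` does it. WHY IT MIGHT FAIL: only through the Lean distance — the `H¹` local
existence theorem must be produced in the tree's Leray–Hopf class (`IsLerayHopfOn`: weak form,
energy inequalities from a.e. `s`, weak `L²` continuity, strong attainment of the datum) for data
that are merely `H¹` and weakly divergence free (no smoothness, no decay).
[FujitaKato1964 Thm 1.1; Kato1984; RobinsonRodrigoSadowski2016 Thm 6.8, Lemma 6.11, Thm 8.17;
LemarieRieusset2016 Thm 7.3, Thm 12.2] -/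
theorem stub_finiteLevelFlows : FiniteLevelFlows := by
  sorry

/-- **S1 `stub_remainderFlows` — SMALL-`L³` REMAINDERS LAUNCH GLOBAL FLOWS THAT DO NOT GROW
ENSTROPHY** (size M–L in Lean; KNOWN in print modulo bookkeeping; the route's "RemainderDecay").
WHY PLAUSIBLE: (i) bookkeeping from the split structure: `r n = u n 0 - Σ_j φ j (· - x n j)` is in
`L²` (`IsLerayHopfOn.memLp` at `t = 0`, `profile_memLp`, translation invariance of Lebesgue measure)
and weakly divergence free (`IsLerayHopfTrajectory.divFree`, `profile_divFree`; `IsWeaklyDivFree` is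
linear on `L²` fields since `⟪f, ∇θ⟫` is integrable for `f ∈ L²`, `θ ∈ C_c^∞`); eventually
`‖∇ r n‖² < ∞` (`budget_orthogonal`: `limsup ≤ Z`) so `r n ∈ H¹ ⊂ L³`, and eventually
`‖r n‖₃ < ε₀` (`remainder_small`: `limsup ‖r n‖₃ ≤ ε < ε₀`, `Filter.eventually_lt_of_limsup_lt`);
(ii) Kato's global theorem for `‖r n‖₃ ≤ δν` (Kato 1984 Thm 2/4; tree `kato_global_small_holds`,
`exists_global_kato_of_small_L3`) gives a global mild solution `R n`, `R n 0 = r n`, continuous in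
`L³` with `‖(R n)(t)‖₃ ≤ 2‖r n‖₃` and `‖(R n)(t)‖_∞ ≤ C t^{-1/2}`, which is a Leray–Hopf trajectory on
every `[0, S)` (ESS 2003 Thm 7.4 / Remark 7.5; tree `IsKatoSolutionOn.isLerayHopfOn_of_memLp_two`);
(iii) enstrophy monotonicity: `R n` is smooth for `t > 0` and `H¹`-continuous at `0⁺` (Fujita–Kato
in `H¹`; Kato = strong solution by uniqueness, tree `kato_unique_holds`), and
`d/dt ‖∇R‖² = -2ν‖∇²R‖² - 2∫ (R·∇R)·ΔR ≤ -2(ν - C_S ‖R(t)‖₃) ‖∇²R‖² ≤ 0` once `2 C_S ε₀ ≤ ν`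
(Hölder `3 · 6 · 2` and Sobolev `‖∇R‖₆ ≤ C_S ‖∇²R‖₂`), so `‖∇(R n)(t)‖² ≤ ‖∇ r n‖²` for all
`t ≥ 0`. WHY IT MIGHT FAIL: only through the Lean distance — the enstrophy balance of a Kato solution
from `H¹ ∩ L³`-small data (time derivative of `eWeakGradL2Sq` along a mild solution, continuity at
`0⁺`) is not in the tree; the threshold must be uniform (`ε₀` depends on `ν` only, by scaling).
[Kato1984 Thm 2, Thm 4; FujitaKato1964; EscauriazaSereginSverak2003 Thm 7.4, Rem. 7.5;
RobinsonRodrigoSadowski2016 Thm 6.8, §8; LemarieRieusset2016 Thm 7.3; Gallagher2001 §2] -/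
theorem stub_remainderFlows : RemainderFlows := by
  sorry

/-- **S2 `stub_asymptoticDecoupling` — PEAK ENSTROPHY ≤ SUM OF THE PIECES' PEAK ENSTROPHIES**
(size L–XL; OPEN — the heart of the crux, the route's "AsymptoticDecoupling"). WHY PLAUSIBLE
(nonlinear profile decomposition run in the SUBCRITICAL class `H¹` at fixed energy, after
Gérard 1998 Thm 1.1 / Gallagher 2001 Thm 1–2 / Bahouri–Gérard, Kenig–Merle 2006 §4): write
`u n = Σ_j P j (·, · - x n j) + R n + w n`. At a finite level the profile flows are strong on
`[0, T]` with `sup_{[0,T]} ‖∇P j‖² ≤ 𝒵(E, ‖∇φ j‖², T) < ∞` (they are admissible), and for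
`ε ≤ ε₀(ν)` the remainder flows are Kato's small global solutions, unique among Leray–Hopf
solutions (weak–strong uniqueness, tree `weak_strong_uniqueness` / `kato_unique_holds`), with
`sup_t ‖R n(t)‖₃ ≤ 2ε`. The error `w n` (zero datum) is forced by the cross terms
`(P j·∇)P k` (`j ≠ k`, frames diverging ⇒ `→ 0` in every `L^p`, Gallagher 2001 Lemma 3.2) and
`(P j·∇)R n + (R n·∇)P j = div(P j ⊗ R n + R n ⊗ P j)`, which is `O(ε)` in `L^∞_t Ḣ⁻¹`
(`‖P ⊗ R‖₂ ≤ ‖R‖₃ ‖P‖₆`) and `O(1)` in `L^∞_t L²` (`‖P‖_∞ ‖∇R‖₂`), hence `O(√ε)` in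
`L^∞_t Ḣ^{-1/2}` by interpolation; Duhamel with `‖∇e^{ντΔ} f‖₂ ≲ (ντ)^{-3/4} ‖f‖_{Ḣ^{-1/2}}`
(integrable at `τ = 0`) and a Gronwall argument in `Ḣ¹` against the strong fields
(`|⟨(w·∇)w, R⟩| ≤ C ‖R‖₃ ‖∇w‖₂²` absorbed for `ε` small) give `sup_{[0,T]} ‖∇ w n‖₂ ≲_level T^{1/4} √ε`;
finally `‖∇u n(t n)‖² ≤ (1+δ)[Σ_j ‖∇P j(t n)‖² + ‖∇R n(t n)‖² + cross] + C_δ ‖∇w n(t n)‖²` with the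
gradient cross terms `⟨∇P j(t, · - x n j), ∇R n(t)⟩ → 0` (small-data Kato flows are weakly-∗ stable:
`r n (· + x n j) ⇀ 0` ⇒ `R n (t, · + x n j) ⇀ 0`, Auscher–Dubois–Tchamitchian 2004 type; or
directly `R n = e^{νtΔ} r n + O_{L³}(ε²)`), and `δ`, `ε` chosen after `γ`. Uniqueness makes the
`∀ P, ∀ R` form equivalent to the statement for THE flows. WHY IT MIGHT FAIL (= the crux's): the
remainder is only `L³`-small, not `H¹`-small — if the `Ḣ^{-1/2}`-interpolation gain is eaten by the
`n`-dependence of `‖∇R n‖_{L²_t L²}`-type norms near `t = 0` (no smoothing uniform in `n` for `H¹`-large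
remainders), enstrophy can migrate profile → remainder by `O(1)` over `[0, T]` and the peak exceeds the
decoupled sum by more than `γ`; also observation times `t n → 0` must be handled uniformly.
CHEAPEST FALSIFIER (first Picard iterate, pen-and-paper or a short kit script): `J = 1`, `φ` a
vortex ring of enstrophy `Z/2`, and the two extreme `L³`-small remainders of enstrophy `Z/2` —
(a) high frequency `r n = n⁻¹ curl(ψ sin(n x₁) e₃)` (dissipates by `t ∼ ν⁻¹n⁻²`), (b) a swarm of
`N = a⁻²` unit bumps of amplitude `a → 0` on a lattice (`‖r‖₃³ ∼ a`); KILL if the `Ḣ¹` norm at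
`t n` of the Duhamel cross term `∫₀ᵗ ∇e^{ν(t-s)Δ}ℙ div(P_φ ⊗ R n + R n ⊗ P_φ) ds` does not tend
to `0` (in (a) it is `O(n⁻¹)`, in (b) `O(a)` per bump with `O(1)` bumps in reach — consistent).
[Gerard1998 Thm 1.1; Gallagher2001 Thm 1, Thm 2, Lemma 3.2;
KenigMerle2006 §4; Kato1984; GallagherIftimiePlanchon2003; AuscherDuboisTchamitchian2004] -/
theorem stub_asymptoticDecoupling : AsymptoticDecoupling := by
  sorry

/-! ## Name-keyed aliases of the three statements — the hypotheses of `SplittingBound_of`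

The native skeleton audit (`#h21_check_skeleton`, run by `ledger skeleton check`) admits a
hypothesis of the composing theorem only if its head constant is a registered obligation or is
NAMED like a declared stub; `__Registered.stub_X` is statement `X` under the registered stub's
short name (device of `Cruxes/ThresholdEnstrophyStable/Lines/birth.lean`,
`Cruxes/ClockLaw/Lines/birth.lean`). Each alias is an `abbrev`, definitionally its statement. -/
namespace __Registered

/-- Alias of `FiniteLevelFlows` keyed by the registered stub name. -/
abbrev stub_finiteLevelFlows : Prop := FiniteLevelFlows
/-- Alias of `RemainderFlows` keyed by the registered stub name. -/
abbrev stub_remainderFlows : Prop := RemainderFlows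
/-- Alias of `AsymptoticDecoupling` keyed by the registered stub name. -/
abbrev stub_asymptoticDecoupling : Prop := AsymptoticDecoupling

end __Registered

/-! ## Proved: precision monotonicity of profile splits, and the composition -/

/-- A profile-split sequence of precision `ε` is one of every coarser precision `ε' ≥ ε` (only the
field `remainder_small` sees `ε`). -/
theorem isProfileSplitSequence_mono {ν T ε ε' : ℝ} {E Z : ℝ≥0} {J : ℕ} {D : ProfileSplitData J}
    (h : IsProfileSplitSequence ν E Z T ε D) (hle : ε ≤ ε') : IsProfileSplitSequence ν E Z T ε' D :=
  { h with remainder_small := h.remainder_small.trans (ENNReal.ofReal_le_ofReal hle) }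

/-- **`SplittingBound` from the three stub statements** (the crux BY NAME; the hypotheses are the
name-keyed aliases of the stub statements; no `sorry` of its own). Given `ν`, take `ε₀` from S1 and,
at the finite level `(E, Z, T)` with margin `γ`, `ε₂` from S2; answer with `ε := min ε₂ (ε₀ / 2)`.
For an `ε`-split `D`: it is an `ε₂`-split (`isProfileSplitSequence_mono`); its profiles are
admissible data within budget, so S0 gives their flows `U j` with lifespans `S j > T`; S1 (as
`ε < ε₀`) gives eventual remainder flows `R n` on `[0, T + 1)` with non-increasing enstrophy; S2
bounds the peak by `Σ_j sup_{[0,T]} ‖∇U j‖² + limsup_n sup_{[0,T]} ‖∇R n‖² + γ`; each profile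
peak is `≤ 𝒵(E, ‖∇φ j‖², T)` because `U j` is admissible at budget `(E, ‖∇φ j‖²)`
(`eWeakGradL2Sq_le_maxEnstrophy`), and `sup_{[0,T]} ‖∇R n‖² ≤ ‖∇ r n‖²` eventually, whence
`Filter.limsup_le_limsup`. -/
theorem SplittingBound_of :
    __Registered.stub_finiteLevelFlows → __Registered.stub_remainderFlows →
      __Registered.stub_asymptoticDecoupling →
        Theses.ExtremalEnstrophy.SplittingBound := by
  intro hS0 hS1 hS2
  intro ν hν E Z T hE hZ hT hfin γ hγ
  obtain ⟨ε₀, hε₀, hrem⟩ := hS1 ν hν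
  obtain ⟨ε₂, hε₂, hdec⟩ := hS2 ν hν E Z T hE hZ hT hfin γ hγ
  refine ⟨min ε₂ (ε₀ / 2), lt_min hε₂ (half_pos hε₀), ?_⟩
  intro J D hD
  have hD₂ : IsProfileSplitSequence ν E Z T ε₂ D := isProfileSplitSequence_mono hD (min_le_left _ _)
  have hεlt : min ε₂ (ε₀ / 2) < ε₀ := (min_le_right _ _).trans_lt (half_lt_self hε₀)
  -- S0: profile flows past the horizon (the profiles are admissible data within budget)
  have hP : ∀ j : Fin J, ∃ S : ℝ, T < S ∧ ∃ U : ℝ → ℝ³ → ℝ³,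
      IsLerayHopfTrajectory ν S U ∧ U 0 = D.φ j := fun j =>
    hS0 ν hν E Z T hT hfin (D.φ j) (hD.profile_memLp j) (hD.profile_divFree j)
      (hD.profile_energy_le j) (hD.eWeakGradL2Sq_profile_le j)
  choose S hS U hU using hP
  -- S1: eventual remainder flows on `[0, T + 1)` with non-increasing enstrophy
  obtain ⟨R, hR⟩ := hrem E Z T (min ε₂ (ε₀ / 2)) hεlt J D hD (T + 1) (by linarith)
  have hR' : ∀ᶠ n in atTop, IsLerayHopfTrajectory ν (T + 1) (R n) ∧ R n 0 = D.r n :=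
    hR.mono fun n hn => ⟨hn.1, hn.2.1⟩
  -- S2: the peak is at most the sum of the pieces' peaks, up to `γ`
  have key := hdec J D hD₂ S U (T + 1) R (fun j => ⟨hS j, (hU j).1, (hU j).2⟩) (by linarith) hR'
  -- each profile peak is below the value function at the profile's own budget
  have h1 : ∀ j, (⨆ t ∈ Icc 0 T, eWeakGradL2Sq (U j t)) ≤
      maxEnstrophy ν E (eWeakGradL2Sq (D.φ j)).toNNReal T := by
    intro j
    refine iSup₂_le fun t ht => ?_
    have hφfin : eWeakGradL2Sq (D.φ j) ≠ ⊤ :=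
      ne_top_of_le_ne_top ENNReal.coe_ne_top (hD.eWeakGradL2Sq_profile_le j)
    have hE' : eEnergy (U j 0) ≤ E := by
      rw [(hU j).2]; exact hD.profile_energy_le j
    have hZ' : eWeakGradL2Sq (U j 0) ≤ ((eWeakGradL2Sq (D.φ j)).toNNReal : ℝ≥0∞) := by
      rw [(hU j).2, ENNReal.coe_toNNReal hφfin]
    exact eWeakGradL2Sq_le_maxEnstrophy (hU j).1 hE' hZ' ht.1 ht.2 (ht.2.trans_lt (hS j))
  -- the remainder peaks are eventually below the remainders' initial enstrophy
  have h2 : limsup (fun n => ⨆ t ∈ Icc 0 T, eWeakGradL2Sq (R n t)) atTop ≤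
      limsup (fun n => eWeakGradL2Sq (D.r n)) atTop := by
    refine Filter.limsup_le_limsup (hR.mono fun n hn => ?_)
    exact iSup₂_le fun t ht => hn.2.2 t ht.1 (by linarith [ht.2])
  calc limsup (fun n => eWeakGradL2Sq (D.u n (D.t n))) atTop
      ≤ (∑ j, ⨆ t ∈ Icc 0 T, eWeakGradL2Sq (U j t)) +
          limsup (fun n => ⨆ t ∈ Icc 0 T, eWeakGradL2Sq (R n t)) atTop + γ := key
    _ ≤ (∑ j, maxEnstrophy ν E (eWeakGradL2Sq (D.φ j)).toNNReal T) +
          limsup (fun n => eWeakGradL2Sq (D.r n)) atTop + γ :=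
        add_le_add (add_le_add (Finset.sum_le_sum fun j _ => h1 j) h2) le_rfl

/-- WIRING CHECK: the three sorried stubs compose to a closed term of the crux's type (modulo their
`sorry`s). Deliberately an `example` (no constant of type `SplittingBound` enters the environment),
so that a BC3 probe importing this file cannot close `stub → crux` by `exact?` through a
pre-composed witness. -/
example : Theses.ExtremalEnstrophy.SplittingBound :=
  SplittingBound_of stub_finiteLevelFlows stub_remainderFlows stub_asymptoticDecoupling

end Summit.NavierStokesRegularity.NavierStokesRegularity.Cruxes.SplittingBound.Birth

end
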